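import Summits.Ventures.CertifiedManyBodySolver.Observables.PhaseSeparationExclusionBoxThermalHotAnchor
import Literature.MathematicalPhysics.QuantumLattice.HubbardTTPrimeFreeGCPressure
import HarnessLib

/-!
# Ventures/CertifiedManyBodySolver — Observables/PhaseSeparationExclusionBoxThermalFreeDilute.lean: the DILUTE partner's `T > 0` anchor
# is the FREE `t–t′` Fermi gas — cell forms with `s`-dependent anchors at BOTH outer densities

HONEST FRAMING: a transport device for the hot-anchored competing-order words (`Observables/PhaseSeparationExclusionBoxThermalHotAnchor.lean`,
this seat g20/g24): EXCLUSION of MACROSCOPIC PHASE COEXISTENCE (a phase of density `≤ n₁` with a phase of density `≥ n₂`) in CANONICAL THERMAL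
torus-limit states on a `(t′, U)` cell, for every `β ≥ β₀`; CONTROL class; conditional on the rows and `n₂`-anchors an instance names; nothing
about stripes, about which phase is realised, or about superconductivity; no number of record. Zero compute, no definition, no claim node.

THE DEVICE (filling lane, g25). Until now every hot-anchored word carried, for the DILUTE density `n₁`, the a-priori cap `p(β_h = 0; n₁) ≤ 2 H_b(n₁/2)`
(`0.666 … 1.055` for `n₁ = 1/5 … 2/5`), i.e. `20–45 %` of the numerator of `β₀`. The canonical pressure is ANTITONE in `U`, so at every `U ≥ 0`
`p(β_h; 1, s, U; n₁) ≤ P₀(β_h, s, μ) − β_h μ n₁` for every real `μ` (`pressureTT'_le_of_freeGCPressureTT'_le`,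
`Literature/…/HubbardTTPrimeFreeGCPressure.lean`, g25), `P₀` the free `t–t′` grand-canonical pressure — a kernel theorem per `(β_h, s, μ)`
(`Certificates/HubbardTTPrime_freeGC_kernelQuadrature_b8_*_dilute.lean`, NO claim node). Two such ceilings at the `t′`-ends of a cell give, by
convexity in `t′` (`pressureTT'_le_schord_of_anchors`), an anchor `Q₁(s)` AFFINE in `s` on the whole cell (§1); the staircase `β_h → β` of the law then
runs on the kinematic dilute floor `F₁(s)` (a `t′`-chord of Fermi-sea tangent rows), which is EXACT for the free gas, so the dilute bracket
`Q₁(s) + β_h F₁(s)` is the free gas's thermal entropy-like excess `≈ 0.05–0.08` at `β_h·t = 8` instead of `0.67–1.05`: every threshold drops `16–24 %`.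
§2 gives the column × threshold forms with BOTH anchors `s`-dependent (`Q₁(s)`, `Q₂(s)`) and the cap affine in `(s, U)` (`c₀ + c_s·s + c₁·U`;
`c_s = 0` editions included), proved exactly as the parent's `…hotAnchorS` / `…_tcap` forms from `psT_not_thermal_mix_on_cell_of_fns_hotAnchorFn`.

Cell `pub/hubbard-downfold` (MO-S1 ↔ S2 seam «box ↦ one word»; D-0096 (ii)+(iii), `T` axis of the D-0098 map), seat `hubbard-downfold-unc-2` (g25).
References: R. B. Israel, *Convexity in the Theory of Lattice Gases* (1979) Thm I.2.4 / I.3.4 [Israel1979]; D. Ruelle, *Statistical Mechanics* (1969)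
§3.3–3.4 [Ruelle1969]; R. B. Griffiths, J. Math. Phys. 5 (1964) 1215 §II [Griffiths1966]; D. Poulin, M. B. Hastings, PRL 106 (2011) 080403
[PoulinHastings2011].
-/

noncomputable section

namespace Summit.Ventures.CertifiedManyBodySolver.Observables

open Literature.MathematicalPhysics.QuantumLattice Literature.MathematicalPhysics.QuantumLattice.ThermodynamicLimit
open Literature.MathematicalPhysics.QuantumLattice.InfVolFermionState Set Filter

/-! ## §1 The free-gas dilute anchor on a cell -/

/-- **THE FREE-GAS DILUTE ANCHOR ON A CELL** (`t = 1`; `β_h ≥ 0`, `0 ≤ n < 2`, `s_a < s_b`): two kernel ceilings of the free `t–t′` grand-canonical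
pressure `P₀(β_h, s_a, μ_a) ≤ P_a`, `P₀(β_h, s_b, μ_b) ≤ P_b` give, for every `s ∈ [s₁, s₂] ⊆ [s_a, s_b]` and every `U ∈ [U₁, U₂]` with `U₁ ≥ 0`,
`p(β_h; 1, s, U; n) ≤ ((s_b − s)(P_a − β_h μ_a n) + (s − s_a)(P_b − β_h μ_b n))/(s_b − s_a)` (free end at `U = 0` by the Legendre ceiling, antitone in
`U`, convex in `t′`). [cite: Ruelle1969, §3.4] [cite: Israel1979, Thm. I.3.4] [cite: Griffiths1966, §II] -/
theorem pressureTT'_le_schord_of_freeGCPressureTT' {βh : ℝ} (hβh : 0 ≤ βh) {n : ℝ} (hn0 : 0 ≤ n) (hn2 : n < 2)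
    {sa sb μa μb Pa Pb : ℝ} (hab : sa < sb) (hA : freeGCPressureTT' βh sa μa ≤ Pa) (hB : freeGCPressureTT' βh sb μb ≤ Pb)
    {s₁ s₂ U₁ U₂ : ℝ} (hs₁ : sa ≤ s₁) (hs₂ : s₂ ≤ sb) (hU₁ : 0 ≤ U₁) :
    ∀ s ∈ Icc s₁ s₂, ∀ U ∈ Icc U₁ U₂,
      pressureTT' βh 1 s U n ≤ ((sb - s) * (Pa - βh * μa * n) + (s - sa) * (Pb - βh * μb * n)) / (sb - sa) :=
  pressureTT'_le_schord_of_anchors hβh 1 hn0 hn2 le_rfl le_rfl hab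
    (pressureTT'_le_of_freeGCPressureTT'_le hβh sa le_rfl hn0 hn2 hA)
    (pressureTT'_le_of_freeGCPressureTT'_le hβh sb le_rfl hn0 hn2 hB) hs₁ hs₂ hU₁ hU₁

/-- **ONE free ceiling on a `t′`-COLUMN** (`s` fixed): `P₀(β_h, s, μ) ≤ P` gives `p(β_h; 1, s, U; n) ≤ P − β_h μ n` for every `U ∈ [U₁, U₂]`,
`U₁ ≥ 0` (the degenerate cell `s₁ = s₂ = s`). [cite: Ruelle1969, §3.4] -/
theorem pressureTT'_le_const_of_freeGCPressureTT' {βh : ℝ} (hβh : 0 ≤ βh) {n : ℝ} (hn0 : 0 ≤ n) (hn2 : n < 2)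
    {s₀ μ P : ℝ} (hA : freeGCPressureTT' βh s₀ μ ≤ P) {U₁ U₂ : ℝ} (hU₁ : 0 ≤ U₁) :
    ∀ s ∈ Icc s₀ s₀, ∀ U ∈ Icc U₁ U₂, pressureTT' βh 1 s U n ≤ P - βh * μ * n := by
  intro s hs U hU
  have hs0 : s = s₀ := le_antisymm hs.2 hs.1
  rw [hs0]
  exact pressureTT'_le_of_freeGCPressureTT'_le hβh s₀ (hU₁.trans hU.1) hn0 hn2 hA

/-! ## §2 Column × threshold forms with `s`-dependent anchors at BOTH outer densities -/

/-- **COLUMN × THRESHOLD FORM, `s`-DEPENDENT ANCHORS `Q₁(s)`, `Q₂(s)`, CAP AFFINE IN `(s, U)`.** Cell `[s₁, s₂] × [U₁, U₂]` (`0 ≤ U₁ < U₂`),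
`0 ≤ n₁ < n₂ < 2`, weights `a + b = 1`; cap `e(t, s, U, a n₁ + b n₂) ≤ c₀ + c_s·s + c₁·U` on the cell; column laws `L_i(s) ≤ e(t, s, U_i, n₂)`; dilute
floor `F₁(s)`; anchors `p(β_{h,1}; n₁) ≤ Q₁(s)`, `p(β_{h,2}; n₂) ≤ Q₂(s)` on the cell (`0 ≤ β_{h,i} ≤ β₀ ≤ β`); on BOTH columns the `T = 0` margin is
`≥ 0` and `a Q₁(s) + b Q₂(s) + β_{h,1} a F₁(s) + β_{h,2} b L_i(s) < β₀·(a F₁(s) + b L_i(s) − (c₀ + c_s s + c₁ U_i))` for every `s` (all data affine in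
`s` ⇒ two checks per column). Then the `(≤ n₁ | ≥ n₂)` coexistence is excluded in every canonical thermal state at `(β; t, s, U; n)` on the cell.
[cite: Israel1979, Thm. I.2.4] [cite: PoulinHastings2011, eqs. (3)–(8)] [cite: Ruelle1969, §3.3] -/
theorem psT_not_thermal_mix_on_cell_of_columns_hotAnchorSS_tcap (t : ℝ) {s₁ s₂ U₁ U₂ n₁ n₂ a b c₀ cs c₁ β β₀ βh₁ βh₂ : ℝ}
    (hU₁ : 0 ≤ U₁) (h12 : U₁ < U₂) (hn₁ : 0 ≤ n₁) (hn : n₁ < n₂) (hn₂ : n₂ < 2) (ha : 0 ≤ a) (hb : 0 ≤ b)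
    (hab : a + b = 1) (hβh₁ : 0 ≤ βh₁) (hβh₂ : 0 ≤ βh₂) (h0₁ : βh₁ ≤ β₀) (h0₂ : βh₂ ≤ β₀) (hβ₀ : β₀ ≤ β)
    (hβ₀pos : 0 < β₀) {L₁ L₂ F₁ Q₁ Q₂ : ℝ → ℝ}
    (hC : ∀ s ∈ Icc s₁ s₂, ∀ U ∈ Icc U₁ U₂, energyDensityTT' t s U (a * n₁ + b * n₂) ≤ c₀ + cs * s + c₁ * U)
    (hL₁ : ∀ s ∈ Icc s₁ s₂, L₁ s ≤ energyDensityTT' t s U₁ n₂) (hL₂ : ∀ s ∈ Icc s₁ s₂, L₂ s ≤ energyDensityTT' t s U₂ n₂)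
    (hF₁ : ∀ s ∈ Icc s₁ s₂, ∀ U ∈ Icc U₁ U₂, F₁ s ≤ energyDensityTT' t s U n₁)
    (hπ₁ : ∀ s ∈ Icc s₁ s₂, ∀ U ∈ Icc U₁ U₂, pressureTT' βh₁ t s U n₁ ≤ Q₁ s)
    (hπ₂ : ∀ s ∈ Icc s₁ s₂, ∀ U ∈ Icc U₁ U₂, pressureTT' βh₂ t s U n₂ ≤ Q₂ s)
    (hm₁ : ∀ s ∈ Icc s₁ s₂, 0 ≤ a * F₁ s + b * L₁ s - (c₀ + cs * s + c₁ * U₁))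
    (hm₂ : ∀ s ∈ Icc s₁ s₂, 0 ≤ a * F₁ s + b * L₂ s - (c₀ + cs * s + c₁ * U₂))
    (hg₁ : ∀ s ∈ Icc s₁ s₂,
      a * Q₁ s + b * Q₂ s + βh₁ * (a * F₁ s) + βh₂ * (b * L₁ s) < β₀ * (a * F₁ s + b * L₁ s - (c₀ + cs * s + c₁ * U₁)))
    (hg₂ : ∀ s ∈ Icc s₁ s₂,
      a * Q₁ s + b * Q₂ s + βh₁ * (a * F₁ s) + βh₂ * (b * L₂ s) < β₀ * (a * F₁ s + b * L₂ s - (c₀ + cs * s + c₁ * U₂)))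
    {s : ℝ} (hs : s ∈ Icc s₁ s₂) {U : ℝ} (hU : U ∈ Icc U₁ U₂)
    {ω₁ ω₂ : InfVolFermionState 2} (h₁ : ω₁.IsTranslationInvariant) (h₂ : ω₂.IsTranslationInvariant)
    (hρ₁ : 0 < ω₁.density) (hρ₁' : ω₁.density ≤ n₁) (hρ₂ : n₂ ≤ ω₂.density) (hρ₂' : ω₂.density < 2)
    {n : ℝ} (hn0 : 0 < n) (hn2 : n < 2) {lam : ℝ} (hl0 : 0 < lam) (hl1 : lam < 1) {Ls : ℕ → ℕ}
    (hLs : Tendsto Ls atTop atTop) :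
    ¬ (mix lam hl0.le hl1.le ω₁ ω₂).IsTorusLimitOfMixture (sectorGibbsCount n) (fun L => sectorGibbsWeightTT' β t s U n L)
      (fun L => sectorGibbsVectorTT' t s U n L) Ls := by
  have hn2' : 0 ≤ n₂ := hn₁.trans hn.le
  have hβ0pos : 0 < β := hβ₀pos.trans_le hβ₀
  refine psT_not_thermal_mix_on_cell_of_fns_hotAnchorFn t hU₁ hβ0pos hn₁ hn hn₂ ha hb hab hβh₁ hβh₂ (h0₁.trans hβ₀)
    (h0₂.trans hβ₀) (C := fun s U => c₀ + cs * s + c₁ * U) (F₁ := fun s _ => F₁ s)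
    (F₂ := fun s U => ((U₂ - U) * L₁ s + (U - U₁) * L₂ s) / (U₂ - U₁)) (P₁ := fun s _ => Q₁ s) (P₂ := fun s _ => Q₂ s) hC hF₁
    (floor_on_cell_of_columnLaws t hn2' hn₂ hU₁ h12 hL₁ hL₂) hπ₁ hπ₂ ?_ hs hU h₁ h₂ hρ₁ hρ₁' hρ₂ hρ₂' hn0 hn2 hl0 hl1 hLs
  intro s hs U hU
  have hd : (U₂ - U₁) ≠ 0 := (sub_pos.2 h12).ne'
  have e₁ : a * Q₁ s + b * Q₂ s <
      β₀ * (a * F₁ s + b * L₁ s - (c₀ + cs * s + c₁ * U₁)) - (βh₁ * (a * F₁ s) + βh₂ * (b * L₁ s)) := by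
    have := hg₁ s hs; linarith
  have e₂ : a * Q₁ s + b * Q₂ s <
      β₀ * (a * F₁ s + b * L₂ s - (c₀ + cs * s + c₁ * U₂)) - (βh₁ * (a * F₁ s) + βh₂ * (b * L₂ s)) := by
    have := hg₂ s hs; linarith
  have hchord := chord_gt_of_ends_gt h12 hU e₁ e₂
  have hid : β₀ * (a * F₁ s + b * (((U₂ - U) * L₁ s + (U - U₁) * L₂ s) / (U₂ - U₁)) - (c₀ + cs * s + c₁ * U)) -
        (βh₁ * (a * F₁ s) + βh₂ * (b * (((U₂ - U) * L₁ s + (U - U₁) * L₂ s) / (U₂ - U₁)))) =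
      ((U₂ - U) * (β₀ * (a * F₁ s + b * L₁ s - (c₀ + cs * s + c₁ * U₁)) - (βh₁ * (a * F₁ s) + βh₂ * (b * L₁ s))) +
        (U - U₁) * (β₀ * (a * F₁ s + b * L₂ s - (c₀ + cs * s + c₁ * U₂)) - (βh₁ * (a * F₁ s) + βh₂ * (b * L₂ s)))) /
        (U₂ - U₁) := by
    field_simp
    ring
  rw [← hid] at hchord
  have hge := chord_ge_of_ends_ge h12 hU (hm₁ s hs) (hm₂ s hs)
  have hidM : a * F₁ s + b * (((U₂ - U) * L₁ s + (U - U₁) * L₂ s) / (U₂ - U₁)) - (c₀ + cs * s + c₁ * U) =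
      ((U₂ - U) * (a * F₁ s + b * L₁ s - (c₀ + cs * s + c₁ * U₁)) +
        (U - U₁) * (a * F₁ s + b * L₂ s - (c₀ + cs * s + c₁ * U₂))) / (U₂ - U₁) := by
    field_simp
    ring
  have hM : 0 ≤ a * F₁ s + b * (((U₂ - U) * L₁ s + (U - U₁) * L₂ s) / (U₂ - U₁)) - (c₀ + cs * s + c₁ * U) := hidM ▸ hge
  have k := mul_le_mul_of_nonneg_right hβ₀ hM
  show a * Q₁ s + b * Q₂ s + βh₁ * (a * F₁ s) + βh₂ * (b * (((U₂ - U) * L₁ s + (U - U₁) * L₂ s) / (U₂ - U₁))) <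
    β * (a * F₁ s + b * (((U₂ - U) * L₁ s + (U - U₁) * L₂ s) / (U₂ - U₁)) - (c₀ + cs * s + c₁ * U))
  linarith

/-- **ABOVE A COLUMN, `s`-DEPENDENT ANCHORS `Q₁(s)`, `Q₂(s)`, CAP AFFINE IN `(s, U)` WITH `c₁ ≥ 0`**: one column law `L(s) ≤ e(t, s, U₂, n₂)`
(floor for every `U ≥ U₂`), far-end margin and anchored inequality at `(β₀, U₃)` for every `s`; conclusion on `[s₁, s₂] × [U₂, U₃]` for every `β ≥ β₀`.
[cite: Israel1979, Thm. I.2.4] [cite: Griffiths1966, §II] [cite: PoulinHastings2011, eqs. (3)–(8)] -/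
theorem psT_not_thermal_mix_above_column_hotAnchorSS_tcap (t : ℝ) {s₁ s₂ U₂ U₃ n₁ n₂ a b c₀ cs c₁ β β₀ βh₁ βh₂ : ℝ}
    (hU₂ : 0 ≤ U₂) (hc₁ : 0 ≤ c₁) (hn₁ : 0 ≤ n₁) (hn : n₁ < n₂) (hn₂ : n₂ < 2) (ha : 0 ≤ a) (hb : 0 ≤ b)
    (hab : a + b = 1) (hβh₁ : 0 ≤ βh₁) (hβh₂ : 0 ≤ βh₂) (h0₁ : βh₁ ≤ β₀) (h0₂ : βh₂ ≤ β₀) (hβ₀ : β₀ ≤ β) (hβ₀pos : 0 < β₀)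
    {L F₁ Q₁ Q₂ : ℝ → ℝ}
    (hC : ∀ s ∈ Icc s₁ s₂, ∀ U ∈ Icc U₂ U₃, energyDensityTT' t s U (a * n₁ + b * n₂) ≤ c₀ + cs * s + c₁ * U)
    (hL : ∀ s ∈ Icc s₁ s₂, L s ≤ energyDensityTT' t s U₂ n₂)
    (hF₁ : ∀ s ∈ Icc s₁ s₂, ∀ U ∈ Icc U₂ U₃, F₁ s ≤ energyDensityTT' t s U n₁)
    (hπ₁ : ∀ s ∈ Icc s₁ s₂, ∀ U ∈ Icc U₂ U₃, pressureTT' βh₁ t s U n₁ ≤ Q₁ s)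
    (hπ₂ : ∀ s ∈ Icc s₁ s₂, ∀ U ∈ Icc U₂ U₃, pressureTT' βh₂ t s U n₂ ≤ Q₂ s)
    (hm : ∀ s ∈ Icc s₁ s₂, 0 ≤ a * F₁ s + b * L s - (c₀ + cs * s + c₁ * U₃))
    (hg : ∀ s ∈ Icc s₁ s₂,
      a * Q₁ s + b * Q₂ s + βh₁ * (a * F₁ s) + βh₂ * (b * L s) < β₀ * (a * F₁ s + b * L s - (c₀ + cs * s + c₁ * U₃)))
    {s : ℝ} (hs : s ∈ Icc s₁ s₂) {U : ℝ} (hU : U ∈ Icc U₂ U₃)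
    {ω₁ ω₂ : InfVolFermionState 2} (h₁ : ω₁.IsTranslationInvariant) (h₂ : ω₂.IsTranslationInvariant)
    (hρ₁ : 0 < ω₁.density) (hρ₁' : ω₁.density ≤ n₁) (hρ₂ : n₂ ≤ ω₂.density) (hρ₂' : ω₂.density < 2)
    {n : ℝ} (hn0 : 0 < n) (hn2 : n < 2) {lam : ℝ} (hl0 : 0 < lam) (hl1 : lam < 1) {Ls : ℕ → ℕ}
    (hLs : Tendsto Ls atTop atTop) :
    ¬ (mix lam hl0.le hl1.le ω₁ ω₂).IsTorusLimitOfMixture (sectorGibbsCount n) (fun L => sectorGibbsWeightTT' β t s U n L)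
      (fun L => sectorGibbsVectorTT' t s U n L) Ls := by
  have hn2' : 0 ≤ n₂ := hn₁.trans hn.le
  refine psT_not_thermal_mix_on_cell_of_fns_hotAnchorFn t hU₂ (hβ₀pos.trans_le hβ₀) hn₁ hn hn₂ ha hb hab hβh₁ hβh₂
    (h0₁.trans hβ₀) (h0₂.trans hβ₀) (C := fun s U => c₀ + cs * s + c₁ * U) (F₁ := fun s _ => F₁ s) (F₂ := fun s _ => L s)
    (P₁ := fun s _ => Q₁ s) (P₂ := fun s _ => Q₂ s) hC hF₁
    (fun s hs U hU => floor_above_column_of_law t hn2' hn₂ hU₂ hL s hs U hU.1) hπ₁ hπ₂ ?_ hs hU h₁ h₂ hρ₁ hρ₁' hρ₂ hρ₂'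
    hn0 hn2 hl0 hl1 hLs
  intro s hs U hU
  have k := mul_le_mul_of_nonneg_left hU.2 hc₁
  have hM3 := hm s hs
  have hM : a * F₁ s + b * L s - (c₀ + cs * s + c₁ * U₃) ≤ a * F₁ s + b * L s - (c₀ + cs * s + c₁ * U) := by linarith
  have hMU : 0 ≤ a * F₁ s + b * L s - (c₀ + cs * s + c₁ * U) := hM3.trans hM
  have k1 := mul_le_mul_of_nonneg_left hM hβ₀pos.le
  have k2 := mul_le_mul_of_nonneg_right hβ₀ hMU
  have hg' := hg s hs
  show a * Q₁ s + b * Q₂ s + βh₁ * (a * F₁ s) + βh₂ * (b * L s) < β * (a * F₁ s + b * L s - (c₀ + cs * s + c₁ * U))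
  linarith

/-- **COLUMN × THRESHOLD FORM, `s`-DEPENDENT ANCHORS, CAP AFFINE IN `U` ONLY** (`c_s = 0` edition of `…SS_tcap`, the shape of the La-214 / strip
instances: cap plane `c₀ + c₁·U`). [cite: Israel1979, Thm. I.2.4] [cite: PoulinHastings2011, eqs. (3)–(8)] [cite: Ruelle1969, §3.3] -/
theorem psT_not_thermal_mix_on_cell_of_columns_hotAnchorSS (t : ℝ) {s₁ s₂ U₁ U₂ n₁ n₂ a b c₀ c₁ β β₀ βh₁ βh₂ : ℝ}
    (hU₁ : 0 ≤ U₁) (h12 : U₁ < U₂) (hn₁ : 0 ≤ n₁) (hn : n₁ < n₂) (hn₂ : n₂ < 2) (ha : 0 ≤ a) (hb : 0 ≤ b)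
    (hab : a + b = 1) (hβh₁ : 0 ≤ βh₁) (hβh₂ : 0 ≤ βh₂) (h0₁ : βh₁ ≤ β₀) (h0₂ : βh₂ ≤ β₀) (hβ₀ : β₀ ≤ β)
    (hβ₀pos : 0 < β₀) {L₁ L₂ F₁ Q₁ Q₂ : ℝ → ℝ}
    (hC : ∀ s ∈ Icc s₁ s₂, ∀ U ∈ Icc U₁ U₂, energyDensityTT' t s U (a * n₁ + b * n₂) ≤ c₀ + c₁ * U)
    (hL₁ : ∀ s ∈ Icc s₁ s₂, L₁ s ≤ energyDensityTT' t s U₁ n₂) (hL₂ : ∀ s ∈ Icc s₁ s₂, L₂ s ≤ energyDensityTT' t s U₂ n₂)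
    (hF₁ : ∀ s ∈ Icc s₁ s₂, ∀ U ∈ Icc U₁ U₂, F₁ s ≤ energyDensityTT' t s U n₁)
    (hπ₁ : ∀ s ∈ Icc s₁ s₂, ∀ U ∈ Icc U₁ U₂, pressureTT' βh₁ t s U n₁ ≤ Q₁ s)
    (hπ₂ : ∀ s ∈ Icc s₁ s₂, ∀ U ∈ Icc U₁ U₂, pressureTT' βh₂ t s U n₂ ≤ Q₂ s)
    (hm₁ : ∀ s ∈ Icc s₁ s₂, 0 ≤ a * F₁ s + b * L₁ s - (c₀ + c₁ * U₁))
    (hm₂ : ∀ s ∈ Icc s₁ s₂, 0 ≤ a * F₁ s + b * L₂ s - (c₀ + c₁ * U₂))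
    (hg₁ : ∀ s ∈ Icc s₁ s₂,
      a * Q₁ s + b * Q₂ s + βh₁ * (a * F₁ s) + βh₂ * (b * L₁ s) < β₀ * (a * F₁ s + b * L₁ s - (c₀ + c₁ * U₁)))
    (hg₂ : ∀ s ∈ Icc s₁ s₂,
      a * Q₁ s + b * Q₂ s + βh₁ * (a * F₁ s) + βh₂ * (b * L₂ s) < β₀ * (a * F₁ s + b * L₂ s - (c₀ + c₁ * U₂)))
    {s : ℝ} (hs : s ∈ Icc s₁ s₂) {U : ℝ} (hU : U ∈ Icc U₁ U₂)
    {ω₁ ω₂ : InfVolFermionState 2} (h₁ : ω₁.IsTranslationInvariant) (h₂ : ω₂.IsTranslationInvariant)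
    (hρ₁ : 0 < ω₁.density) (hρ₁' : ω₁.density ≤ n₁) (hρ₂ : n₂ ≤ ω₂.density) (hρ₂' : ω₂.density < 2)
    {n : ℝ} (hn0 : 0 < n) (hn2 : n < 2) {lam : ℝ} (hl0 : 0 < lam) (hl1 : lam < 1) {Ls : ℕ → ℕ}
    (hLs : Tendsto Ls atTop atTop) :
    ¬ (mix lam hl0.le hl1.le ω₁ ω₂).IsTorusLimitOfMixture (sectorGibbsCount n) (fun L => sectorGibbsWeightTT' β t s U n L)
      (fun L => sectorGibbsVectorTT' t s U n L) Ls :=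
  psT_not_thermal_mix_on_cell_of_columns_hotAnchorSS_tcap t (c₀ := c₀) (cs := 0) (c₁ := c₁) hU₁ h12 hn₁ hn hn₂ ha hb hab hβh₁ hβh₂ h0₁ h0₂ hβ₀ hβ₀pos
    (fun s hs U hU => by have := hC s hs U hU; linarith) hL₁ hL₂ hF₁ hπ₁ hπ₂
    (fun s hs => by have := hm₁ s hs; linarith) (fun s hs => by have := hm₂ s hs; linarith)
    (fun s hs => by have := hg₁ s hs; linarith) (fun s hs => by have := hg₂ s hs; linarith)
    hs hU h₁ h₂ hρ₁ hρ₁' hρ₂ hρ₂' hn0 hn2 hl0 hl1 hLs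

/-- **ABOVE A COLUMN, `s`-DEPENDENT ANCHORS, CAP AFFINE IN `U` ONLY** (`c_s = 0` edition of `…above_column_hotAnchorSS_tcap`).
[cite: Israel1979, Thm. I.2.4] [cite: Griffiths1966, §II] [cite: PoulinHastings2011, eqs. (3)–(8)] -/
theorem psT_not_thermal_mix_above_column_hotAnchorSS (t : ℝ) {s₁ s₂ U₂ U₃ n₁ n₂ a b c₀ c₁ β β₀ βh₁ βh₂ : ℝ}
    (hU₂ : 0 ≤ U₂) (hc₁ : 0 ≤ c₁) (hn₁ : 0 ≤ n₁) (hn : n₁ < n₂) (hn₂ : n₂ < 2) (ha : 0 ≤ a) (hb : 0 ≤ b)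
    (hab : a + b = 1) (hβh₁ : 0 ≤ βh₁) (hβh₂ : 0 ≤ βh₂) (h0₁ : βh₁ ≤ β₀) (h0₂ : βh₂ ≤ β₀) (hβ₀ : β₀ ≤ β) (hβ₀pos : 0 < β₀)
    {L F₁ Q₁ Q₂ : ℝ → ℝ}
    (hC : ∀ s ∈ Icc s₁ s₂, ∀ U ∈ Icc U₂ U₃, energyDensityTT' t s U (a * n₁ + b * n₂) ≤ c₀ + c₁ * U)
    (hL : ∀ s ∈ Icc s₁ s₂, L s ≤ energyDensityTT' t s U₂ n₂)
    (hF₁ : ∀ s ∈ Icc s₁ s₂, ∀ U ∈ Icc U₂ U₃, F₁ s ≤ energyDensityTT' t s U n₁)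
    (hπ₁ : ∀ s ∈ Icc s₁ s₂, ∀ U ∈ Icc U₂ U₃, pressureTT' βh₁ t s U n₁ ≤ Q₁ s)
    (hπ₂ : ∀ s ∈ Icc s₁ s₂, ∀ U ∈ Icc U₂ U₃, pressureTT' βh₂ t s U n₂ ≤ Q₂ s)
    (hm : ∀ s ∈ Icc s₁ s₂, 0 ≤ a * F₁ s + b * L s - (c₀ + c₁ * U₃))
    (hg : ∀ s ∈ Icc s₁ s₂,
      a * Q₁ s + b * Q₂ s + βh₁ * (a * F₁ s) + βh₂ * (b * L s) < β₀ * (a * F₁ s + b * L s - (c₀ + c₁ * U₃)))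
    {s : ℝ} (hs : s ∈ Icc s₁ s₂) {U : ℝ} (hU : U ∈ Icc U₂ U₃)
    {ω₁ ω₂ : InfVolFermionState 2} (h₁ : ω₁.IsTranslationInvariant) (h₂ : ω₂.IsTranslationInvariant)
    (hρ₁ : 0 < ω₁.density) (hρ₁' : ω₁.density ≤ n₁) (hρ₂ : n₂ ≤ ω₂.density) (hρ₂' : ω₂.density < 2)
    {n : ℝ} (hn0 : 0 < n) (hn2 : n < 2) {lam : ℝ} (hl0 : 0 < lam) (hl1 : lam < 1) {Ls : ℕ → ℕ}
    (hLs : Tendsto Ls atTop atTop) :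
    ¬ (mix lam hl0.le hl1.le ω₁ ω₂).IsTorusLimitOfMixture (sectorGibbsCount n) (fun L => sectorGibbsWeightTT' β t s U n L)
      (fun L => sectorGibbsVectorTT' t s U n L) Ls :=
  psT_not_thermal_mix_above_column_hotAnchorSS_tcap t (c₀ := c₀) (cs := 0) (c₁ := c₁) hU₂ hc₁ hn₁ hn hn₂ ha hb hab hβh₁ hβh₂ h0₁ h0₂ hβ₀ hβ₀pos
    (fun s hs U hU => by have := hC s hs U hU; linarith) hL hF₁ hπ₁ hπ₂
    (fun s hs => by have := hm s hs; linarith) (fun s hs => by have := hg s hs; linarith)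
    hs hU h₁ h₂ hρ₁ hρ₁' hρ₂ hρ₂' hn0 hn2 hl0 hl1 hLs

end Summit.Ventures.CertifiedManyBodySolver.Observables
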